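import Mathlib.MeasureTheory.Function.L2Space
import Mathlib.MeasureTheory.Function.JacobianOneDim
import Mathlib.MeasureTheory.Integral.IntervalIntegral.Periodic
import Mathlib.Algebra.Order.ToIntervalMod
import Mathlib.Topology.Algebra.Group.Quotient
import Literature.NumberTheory.ConnesConsani2023.ZetaCycles
import Literature.NumberTheory.LFunctions.MuentzFormulaSchwartz
import HarnessLib

/-!
# ζ-cycles: unfolding `⟨χ_s | Σ_μ 𝓔(f)⟩` on the circle to a Mellin transform of `𝓔(f)`

RH-FREE corpus literature (Connes–Consani 2023, *Spectral triples and ζ-cycles*, §6; cell rh-crit C1,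
row t11).  Sequel of `ZetaCycles.lean` (statements) and `LFunctions/MuentzFormulaSchwartz.lean`.
Everything here is PROVED; no named facts.  Nothing in this file bears on the truth of RH.

This file formalises the two displayed steps of the proof of Theorem 6.4 (arXiv:2106.01715,
p0019:L20–L28 and L91–L95):

  `∫_G χ(u) Σ_μ 𝓔(f)(u) d^*u = ∫_{ℝ₊^*} u^{is} 𝓔(f)(u) d^*u`   (unfolding the sum over `μ^ℤ`),

in the additive model `u = eˣ` of `ZetaCycles.lean` (circle `AddCircle L`, `L = log μ`, Haar
probability measure, characters `fourier n`, `s = 2πn/L`):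

* `integral_Ioc_mul_tsum_eq_integral` — the unfolding identity
  `∫_{(0,L]} e(x) Σ_{k∈ℤ} Φ(x + kL) dx = ∫_ℝ e(x) Φ(x) dx` for `Φ ∈ L¹(ℝ)` and `e` continuous, bounded,
  `L`-periodic;
* `sigmaE_coe_eq_tsum` — `Σ_μ 𝓔(f)` on the circle IS the `L`-periodisation of `Φ_f(x) = 𝓔(f)(eˣ)`;
* `mellin_eq_integral_comp_exp`, `integrable_comp_exp_of_mellinConvergent` — the substitution `u = eˣ`:
  `∫_0^∞ S(u) u^{s-1} du = ∫_ℝ e^{sx} S(eˣ) dx`;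
* `mellin_ofReal_conj` — for real-valued `S`, `𝓜S(s̄) = conj 𝓜S(s)`;
* **`inner_fourierLp_eq_mellin`** — for `ξ ∈ L²(C)` a.e. equal to `Σ_μ 𝓔(f)` and `sL = 2πn`:
  `⟪fourierLp 2 n, ξ⟫ = L⁻¹ · conj (∫_0^∞ 𝓔(f)(u) u^{is} d^*u) = L⁻¹ · conj (𝓜[𝓔f](is))`, whenever
  `x ↦ 𝓔(f)(eˣ)` is integrable (which `mellin_connesE_schwartz` provides for Schwartz `f` with
  `∫_0^∞ f = 0`);
* **`inner_fourierLp_eq_zeta_mul_mellin`** — combined with eq. (𝓔 ζ):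
  `⟪fourierLp 2 n, ξ⟫ = L⁻¹ · conj (ζ(½ + is) · 𝓜f(½ + is))` for `f ∈ 𝒮^ev_0` (indeed for real Schwartz
  `f` with `∫_0^∞ f = 0`).

## References

* A. Connes, C. Consani, *Spectral triples and ζ-cycles*, Enseign. Math. 69 (2023) 93–148,
  arXiv:2106.01715, §6, proof of Theorem 6.4 [ConnesConsani2023].
-/

noncomputable section

open scoped Topology SchwartzMap ENNReal ComplexConjugate Interval
open Function Filter MeasureTheory Complex Set intervalIntegral AddCircle
open Literature.NumberTheory.LFunctions

namespace Literature.NumberTheory.ConnesConsani2023.ZetaCycles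

/-! ### Unfolding a periodisation against a periodic weight -/

/-- `ℤ`-cells: for `g ∈ L¹(ℝ)` and `L > 0`, `Σ_{k∈ℤ} ∫_{(kL,(k+1)L]} g = ∫_ℝ g` (as a `HasSum`).
(The decomposition of `∫_{ℝ₊^*}` along `μ^ℤ`-translates of a fundamental domain, proof of
Thm 6.4, p0019:L24–L28.) [cite: ConnesConsani2023, proof of Theorem 6.4 (arXiv chunk p0019:L24–L28)] -/
theorem hasSum_setIntegral_Ioc_int_mul {E : Type*} [NormedAddCommGroup E] [NormedSpace ℝ E]
    {g : ℝ → E} (hg : Integrable g) {L : ℝ} (hL : 0 < L) :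
    HasSum (fun k : ℤ => ∫ t in Ioc ((k : ℝ) * L) (((k : ℝ) + 1) * L), g t) (∫ t, g t) := by
  have h := hasSum_integral_iUnion (μ := volume) (f := g)
    (s := fun k : ℤ => Ioc (k • L) ((k + 1) • L)) (fun k => measurableSet_Ioc)
    (pairwise_disjoint_Ioc_zsmul L) (by rw [iUnion_Ioc_zsmul hL]; exact hg.integrableOn)
  rw [iUnion_Ioc_zsmul hL, setIntegral_univ] at h
  simpa only [zsmul_eq_mul, Int.cast_add, Int.cast_one] using h

/-- Translating a cell back to `(0, L]`: `∫_{(kL,(k+1)L]} g = ∫_{(0,L]} g(x + kL) dx`. [folklore] -/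
private theorem setIntegral_Ioc_int_mul_eq {E : Type*} [NormedAddCommGroup E] [NormedSpace ℝ E]
    (g : ℝ → E) {L : ℝ} (hL : 0 < L) (k : ℤ) :
    ∫ t in Ioc ((k : ℝ) * L) (((k : ℝ) + 1) * L), g t = ∫ x in Ioc 0 L, g (x + k * L) := by
  have hle : (k : ℝ) * L ≤ ((k : ℝ) + 1) * L := by nlinarith
  rw [← intervalIntegral.integral_of_le hle, ← intervalIntegral.integral_of_le hL.le,
    intervalIntegral.integral_comp_add_right (fun x => g x) ((k : ℝ) * L)]
  congr 1 <;> ring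

/-- **Unfolding.**  Let `Φ ∈ L¹(ℝ)`, `L > 0`, and `e : ℝ → ℂ` continuous, bounded by `1` and
`L`-periodic.  Then `∫_{(0,L]} e(x) · Σ_{k ∈ ℤ} Φ(x + kL) dx = ∫_ℝ e(x) Φ(x) dx` (the series is summed
under the integral sign because `Σ_k ∫_{(0,L]} |Φ(x + kL)| dx = ∫_ℝ |Φ| < ∞`).  This is the step
`∫_G χ(u) Σ_μ 𝓔(f)(u) d^*u = ∫_{ℝ₊^*} u^{is} 𝓔(f)(u) d^*u` of the proof of Theorem 6.4
(p0019:L20–L28, L94), read additively. [cite: ConnesConsani2023, proof of Theorem 6.4 (arXiv chunk p0019:L20–L28)] -/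
theorem integral_Ioc_mul_tsum_eq_integral {L : ℝ} (hL : 0 < L) {Φ : ℝ → ℂ} (hΦ : Integrable Φ)
    {e : ℝ → ℂ} (hec : Continuous e) (heb : ∀ x, ‖e x‖ ≤ 1) (hep : Function.Periodic e L) :
    ∫ x in Ioc 0 L, e x * ∑' k : ℤ, Φ (x + k * L) = ∫ x, e x * Φ x := by
  -- the terms
  set F : ℤ → ℝ → ℂ := fun k x => e x * Φ (x + k * L) with hF_def
  have heΦ : Integrable (fun x => e x * Φ x) :=
    hΦ.bdd_mul hec.aestronglyMeasurable (Eventually.of_forall heb)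
  -- each term is integrable on `(0, L]`
  have hF_int : ∀ k : ℤ, Integrable (F k) (volume.restrict (Ioc 0 L)) := by
    intro k
    have h1 : Integrable (fun x => Φ (x + k * L)) := hΦ.comp_add_right ((k : ℝ) * L)
    exact (h1.bdd_mul hec.aestronglyMeasurable (Eventually.of_forall heb)).restrict
  -- the `L¹` norms of the terms are summable: they are bounded by the cell integrals of `‖Φ‖`
  have hnorm_cell : ∀ k : ℤ, ∫ x in Ioc 0 L, ‖Φ (x + k * L)‖ =
      ∫ t in Ioc ((k : ℝ) * L) (((k : ℝ) + 1) * L), ‖Φ t‖ := fun k =>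
    (setIntegral_Ioc_int_mul_eq (fun t => ‖Φ t‖) hL k).symm
  have hsum_norm : Summable fun k : ℤ => ∫ x in Ioc 0 L, ‖F k x‖ := by
    have hcells := hasSum_setIntegral_Ioc_int_mul hΦ.norm hL
    refine Summable.of_nonneg_of_le (fun k => integral_nonneg fun x => norm_nonneg _) (fun k => ?_)
      hcells.summable
    rw [← hnorm_cell k]
    refine integral_mono_of_nonneg (Eventually.of_forall fun x => norm_nonneg _)
      ((hΦ.comp_add_right ((k : ℝ) * L)).norm.restrict) (Eventually.of_forall fun x => ?_)
    simp only [hF_def, norm_mul]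
    calc ‖e x‖ * ‖Φ (x + k * L)‖ ≤ 1 * ‖Φ (x + k * L)‖ := by gcongr; exact heb x
      _ = ‖Φ (x + k * L)‖ := one_mul _
  -- interchange sum and integral
  have hswap : ∫ x in Ioc 0 L, e x * ∑' k : ℤ, Φ (x + k * L) = ∑' k : ℤ, ∫ x in Ioc 0 L, F k x := by
    rw [integral_tsum_of_summable_integral_norm hF_int hsum_norm]
    refine setIntegral_congr_fun measurableSet_Ioc fun x _ => ?_
    simp only [hF_def]
    exact (tsum_mul_left).symm
  -- each term, translated back, is the integral of `e Φ` over the cell `(kL, (k+1)L]`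
  have hterm : ∀ k : ℤ, ∫ x in Ioc 0 L, F k x =
      ∫ t in Ioc ((k : ℝ) * L) (((k : ℝ) + 1) * L), e t * Φ t := by
    intro k
    rw [setIntegral_Ioc_int_mul_eq (fun t => e t * Φ t) hL k]
    refine setIntegral_congr_fun measurableSet_Ioc fun x _ => ?_
    simp only [hF_def]
    rw [(hep.int_mul k) x]
  rw [hswap]
  simp_rw [hterm]
  exact (hasSum_setIntegral_Ioc_int_mul heΦ hL).tsum_eq

/-- The same on the circle: if `P : AddCircle L → ℂ` satisfies `P ↑x = Σ_{k∈ℤ} Φ(x + kL)` and `χ` is a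
continuous function on the circle bounded by `1`, then
`∫_C χ P d(haar prob.) = L⁻¹ ∫_ℝ χ(↑x) Φ(x) dx`. [cite: ConnesConsani2023, proof of Theorem 6.4 (arXiv chunk p0019:L20–L28, L94)] -/
theorem integral_haarAddCircle_mul_eq {L : ℝ} [hL : Fact (0 < L)] {Φ : ℝ → ℂ} (hΦ : Integrable Φ)
    {P : AddCircle L → ℂ} (hP : ∀ x : ℝ, P (x : AddCircle L) = ∑' k : ℤ, Φ (x + k * L))
    (χ : C(AddCircle L, ℂ)) (hχ : ∀ y, ‖χ y‖ ≤ 1) :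
    ∫ y, χ y * P y ∂haarAddCircle = (L⁻¹ : ℝ) • ∫ x : ℝ, χ (x : AddCircle L) * Φ x := by
  rw [AddCircle.integral_haarAddCircle, ← AddCircle.intervalIntegral_preimage L 0, zero_add,
    intervalIntegral.integral_of_le hL.out.le]
  congr 1
  have hP' : ∀ x : ℝ, χ (x : AddCircle L) * P (x : AddCircle L) =
      χ (x : AddCircle L) * ∑' k : ℤ, Φ (x + k * L) := fun x => by rw [hP x]
  simp_rw [hP']
  refine integral_Ioc_mul_tsum_eq_integral hL.out hΦ (χ.continuous.comp (AddCircle.continuous_mk' L))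
    (fun x => hχ _) fun x => ?_
  show χ (((x + L : ℝ)) : AddCircle L) = χ ((x : ℝ) : AddCircle L)
  rw [AddCircle.coe_add_period]

/-! ### `Σ_μ 𝓔(f)` is the periodisation of `x ↦ 𝓔(f)(eˣ)` -/

/-- On representatives, `Σ_μ 𝓔(f)(↑x) = Σ_{k ∈ ℤ} 𝓔(f)(e^{x + kL})` (`μ^k eˣ = e^{x+kL}`).
[cite: ConnesConsani2023, §6.1 (arXiv chunk p0018:L10–L18)] -/
theorem sigmaE_coe_eq_tsum (L : ℝ) (f : ℝ → ℝ) (x : ℝ) :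
    sigmaE L f (x : AddCircle L) = ∑' k : ℤ, ((connesE f (Real.exp (x + k * L)) : ℝ) : ℂ) := by
  rw [sigmaE_coe, scaleSum, Complex.ofReal_tsum]
  refine tsum_congr fun k => ?_
  congr 2
  rw [Real.exp_add, mul_comm (Real.exp x), ← Real.rpow_intCast, mul_comm (k : ℝ) L, Real.exp_mul]

/-! ### The substitution `u = eˣ` in a Mellin transform -/

/-- `(eᵗ)^z = e^{tz}` (principal power of a positive real). [folklore] -/
private theorem ofReal_exp_cpow (t : ℝ) (z : ℂ) : ((Real.exp t : ℝ) : ℂ) ^ z = cexp (t * z) := by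
  rw [cpow_def_of_ne_zero (ofReal_ne_zero.2 (Real.exp_pos t).ne'), ← ofReal_log (Real.exp_pos t).le,
    Real.log_exp]

/-- `∫_0^∞ S(u) u^{s-1} du = ∫_ℝ e^{sx} S(eˣ) dx` (both sides junk `0` together when divergent): the
substitution `u = eˣ` behind "`∫_{ℝ₊^*} u^{is} 𝓔(f)(u) d^*u`" (p0019:L27).
[cite: ConnesConsani2023, proof of Theorem 6.4 (arXiv chunk p0019:L27)] -/
theorem mellin_eq_integral_comp_exp (S : ℝ → ℂ) (s : ℂ) :
    mellin S s = ∫ x : ℝ, cexp (s * x) * S (Real.exp x) := by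
  have himg : Real.exp '' univ = Ioi 0 := by rw [image_univ, Real.range_exp]
  have hderiv : ∀ x ∈ (univ : Set ℝ), HasDerivWithinAt Real.exp (Real.exp x) univ x :=
    fun x _ ↦ (Real.hasDerivAt_exp x).hasDerivWithinAt
  rw [mellin, ← himg, integral_image_eq_integral_abs_deriv_smul MeasurableSet.univ hderiv
    Real.exp_injective.injOn, setIntegral_univ]
  refine integral_congr_ae (ae_of_all _ fun x ↦ ?_)
  show |Real.exp x| • (((Real.exp x : ℝ) : ℂ) ^ (s - 1) • S (Real.exp x)) = cexp (s * x) * S (Real.exp x)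
  rw [abs_of_pos (Real.exp_pos x), smul_eq_mul, Complex.real_smul, ofReal_exp_cpow, ← mul_assoc]
  congr 1
  rw [Complex.ofReal_exp, ← Complex.exp_add]
  congr 1
  ring

/-- If the Mellin transform of `S` converges absolutely at `s`, then `x ↦ e^{sx} S(eˣ)` is integrable
on `ℝ` (same substitution). [folklore] -/
private theorem integrable_comp_exp_of_mellinConvergent {S : ℝ → ℂ} {s : ℂ} (h : MellinConvergent S s) :
    Integrable (fun x : ℝ => cexp (s * x) * S (Real.exp x)) := by
  have himg : Real.exp '' univ = Ioi 0 := by rw [image_univ, Real.range_exp]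
  have hderiv : ∀ x ∈ (univ : Set ℝ), HasDerivWithinAt Real.exp (Real.exp x) univ x :=
    fun x _ ↦ (Real.hasDerivAt_exp x).hasDerivWithinAt
  rw [MellinConvergent, ← himg, integrableOn_image_iff_integrableOn_abs_deriv_smul MeasurableSet.univ
    hderiv Real.exp_injective.injOn, integrableOn_univ] at h
  refine h.congr (ae_of_all _ fun x => ?_)
  show |Real.exp x| • (((Real.exp x : ℝ) : ℂ) ^ (s - 1) • S (Real.exp x)) = cexp (s * x) * S (Real.exp x)
  rw [abs_of_pos (Real.exp_pos x), smul_eq_mul, Complex.real_smul, ofReal_exp_cpow, ← mul_assoc]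
  congr 1
  rw [Complex.ofReal_exp, ← Complex.exp_add]
  congr 1
  ring

/-- In particular, if the Mellin transform of `𝓔(f)` converges at `0` then `x ↦ 𝓔(f)(eˣ)` is integrable
on `ℝ`, i.e. `∫_{ℝ₊^*} |𝓔(f)(u)| d^*u < ∞` — the absolute convergence behind "`∫_{ℝ₊^*} u^{is} 𝓔(f)(u) d^*u`"
(Lemma 6.1 (i): `𝓔(f) = O(u^{1/2})` at `0`, rapid decay at `∞`; p0018:L23, p0019:L27).
[cite: ConnesConsani2023, Lemma 6.1 (i) and proof of Theorem 6.4 (arXiv chunks p0018:L23, p0019:L27)] -/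
theorem integrable_connesE_comp_exp {f : ℝ → ℝ}
    (h : MellinConvergent (fun u => (connesE f u : ℂ)) 0) :
    Integrable (fun x : ℝ => ((connesE f (Real.exp x) : ℝ) : ℂ)) := by
  have h1 := integrable_comp_exp_of_mellinConvergent h
  simpa only [zero_mul, Complex.exp_zero, one_mul] using h1

/-- For real-valued `S`: `𝓜S(s̄) = conj 𝓜S(s)`. [folklore] -/
private theorem mellin_ofReal_conj (S : ℝ → ℝ) (s : ℂ) :
    mellin (fun u => ((S u : ℝ) : ℂ)) (conj s) = conj (mellin (fun u => ((S u : ℝ) : ℂ)) s) := by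
  rw [mellin, mellin, ← integral_conj]
  refine setIntegral_congr_fun measurableSet_Ioi fun t ht => ?_
  simp only [smul_eq_mul, map_mul, Complex.conj_ofReal]
  congr 1
  have h0 : (t : ℂ) ≠ 0 := ofReal_ne_zero.2 (ne_of_gt ht)
  rw [cpow_def_of_ne_zero h0, cpow_def_of_ne_zero h0, ← Complex.exp_conj, ← ofReal_log ht.le]
  congr 1
  simp only [map_mul, map_sub, map_one, Complex.conj_ofReal]

/-! ### The inner product `⟨χ_s | Σ_μ 𝓔(f)⟩` as a Mellin transform of `𝓔(f)` -/

/-- The character with `sL = 2πn` read on `ℝ`: `fourier (-n) ↑x = e^{-isx}`. [folklore] -/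
private theorem fourier_neg_coe_eq {L : ℝ} [hL : Fact (0 < L)] {s : ℝ} {n : ℤ}
    (hsL : s * L = 2 * Real.pi * n) (x : ℝ) :
    fourier (-n) (x : AddCircle L) = cexp (-(I * s) * x) := by
  rw [fourier_coe_apply]
  congr 1
  have hL0 : (L : ℂ) ≠ 0 := ofReal_ne_zero.2 hL.out.ne'
  have hs : (s : ℂ) = 2 * Real.pi * n / L := by
    rw [eq_div_iff hL0]; exact_mod_cast hsL
  rw [hs]
  push_cast
  ring

/-- **`⟨χ_s | Σ_μ 𝓔(f)⟩` unfolded** (proof of Theorem 6.4, p0019:L20–L28 and L94): if `ξ ∈ L²(C)` is a.e.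
equal to `Σ_μ 𝓔(f)`, `x ↦ 𝓔(f)(eˣ)` is integrable, and `sL = 2πn`, then
`⟪fourierLp 2 n, ξ⟫ = L⁻¹ · conj (∫_0^∞ 𝓔(f)(u) u^{is} d^*u) = L⁻¹ · conj 𝓜[𝓔 f](is)`
(Mathlib's inner product is conjugate-linear in the first variable, and `𝓔(f)` is real, whence the
conjugation; the Haar probability measure contributes `L⁻¹`).
[cite: ConnesConsani2023, proof of Theorem 6.4 (arXiv chunk p0019:L20–L28, L94)] -/
theorem inner_fourierLp_eq_mellin {L : ℝ} [hL : Fact (0 < L)] {f : ℝ → ℝ}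
    (hint : Integrable (fun x : ℝ => ((connesE f (Real.exp x) : ℝ) : ℂ)))
    {ξ : Lp ℂ 2 (@haarAddCircle L hL)} (hξ : (ξ : AddCircle L → ℂ) =ᵐ[haarAddCircle] sigmaE L f)
    {s : ℝ} {n : ℤ} (hsL : s * L = 2 * Real.pi * n) :
    inner ℂ (fourierLp 2 n : Lp ℂ 2 (@haarAddCircle L hL)) ξ =
      (L⁻¹ : ℝ) • conj (mellin (fun u => (connesE f u : ℂ)) (I * s)) := by
  -- the inner product as an integral of `fourier (-n) · Σ_μ 𝓔(f)`
  have h1 : inner ℂ (fourierLp 2 n : Lp ℂ 2 (@haarAddCircle L hL)) ξ =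
      ∫ y, fourier (-n) y * sigmaE L f y ∂haarAddCircle := by
    rw [MeasureTheory.L2.inner_def]
    refine integral_congr_ae ?_
    filter_upwards [coeFn_fourierLp 2 n, hξ] with y hy1 hy2
    rw [hy1, hy2, RCLike.inner_apply', fourier_neg]
  rw [h1, integral_haarAddCircle_mul_eq hint (sigmaE_coe_eq_tsum L f) (fourier (-n))
    (fun y => le_of_eq (Circle.norm_coe _))]
  congr 1
  -- `∫_ℝ e^{-isx} 𝓔(f)(eˣ) dx = 𝓜[𝓔f](-is) = conj 𝓜[𝓔f](is)`
  have h2 : conj (I * (s : ℂ)) = -(I * s) := by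
    rw [map_mul, Complex.conj_I, Complex.conj_ofReal, neg_mul]
  rw [← mellin_ofReal_conj (connesE f) (I * s), h2, mellin_eq_integral_comp_exp]
  refine integral_congr_ae (ae_of_all _ fun x => ?_)
  show fourier (-n) (x : AddCircle L) * _ = cexp (-(I * s) * x) * _
  rw [fourier_neg_coe_eq hsL x]

/-- **`⟨χ_s | Σ_μ 𝓔(f)⟩ = L⁻¹ · conj(ζ(½ + is) · 𝓜f(½ + is))`** for a real Schwartz `f` with
`∫_0^∞ f = 0` (in particular `f ∈ 𝒮^ev_0`), `sL = 2πn`, and `ξ ∈ L²(C)` a.e. equal to `Σ_μ 𝓔(f)`: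
the unfolding combined with eq. (𝓔 ζ) at `z = -s` ∈ ℝ (proof of Theorem 6.4, p0019:L39 and L85–L94).
[cite: ConnesConsani2023, proof of Theorem 6.4 (arXiv chunk p0019:L39, L85–L94)] -/
theorem inner_fourierLp_eq_zeta_mul_mellin {L : ℝ} [hL : Fact (0 < L)] (f : 𝓢(ℝ, ℝ))
    (hint : ∫ t in Ioi 0, f t = 0)
    {ξ : Lp ℂ 2 (@haarAddCircle L hL)} (hξ : (ξ : AddCircle L → ℂ) =ᵐ[haarAddCircle] sigmaE L f)
    {s : ℝ} {n : ℤ} (hsL : s * L = 2 * Real.pi * n) :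
    inner ℂ (fourierLp 2 n : Lp ℂ 2 (@haarAddCircle L hL)) ξ =
      (L⁻¹ : ℝ) • conj (riemannZeta (1 / 2 + s * I) *
        mellin (fun x => ((f x : ℝ) : ℂ)) (1 / 2 + s * I)) := by
  have h0 := mellin_connesE_schwartz f hint (s := 0) (by norm_num) (by norm_num)
  have hs := mellin_connesE_schwartz f hint (s := I * s) (by simp) (by
    intro h
    have := congrArg Complex.re h
    simp at this)
  rw [inner_fourierLp_eq_mellin (integrable_connesE_comp_exp h0.1) hξ hsL, hs.2]
  congr 3
  · ring
  · ring

end Literature.NumberTheory.ConnesConsani2023.ZetaCycles
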